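import Mathlib
import Literature.NumberTheory.LFunctions.Zhang2022.Section2FunctionalEquation
import Literature.NumberTheory.LFunctions.Zhang2022.Section2CriticalLineReality
import Literature.NumberTheory.LFunctions.DirichletLFunctionBounds
import HarnessLib

/-!
# Polynomial growth of `L(s,θ)` in vertical strips (any `σ`, `|t| → ∞`) for a primitive
# character `θ`, via the functional equation (2.2) and Stirling's formula for `ϑ(s)`

Topic `Literature/NumberTheory/LFunctions/Zhang2022` (Landau–Siegel audit tree; verdict-neutral).
Y. Zhang, *Discrete mean estimates and the Landau–Siegel zero*, arXiv:2211.02515v1 (2022)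
[Zhang2022LandauSiegel] — **an unrefereed manuscript under adjudication**; this file asserts nothing
about its Theorems 1–2. Campaign D-0069 (discharge lane, seat sz-d26): the contour shifts of §6
(proof of Lemma 6.1, p. 31, tex L1711: "moving the line of integration to `u = −1`"), §11 and §13
integrate `L(s+w,ψ)` against the Gaussian kernel `ω₁(w) = exp{w²/4𝓛³⁰}` along vertical lines and
need that `L(σ+it,ψ)` grows at most polynomially in `|t|`, **uniformly for `σ` in a strip that
reaches left of the critical strip** (`Re(s+w) = σ − 1 ≈ −1/2` on the line `u = −1`). This file
PROVES that classical fact in the form the dischargers consume (all constants explicit, no new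
named fact):

* `norm_tau_le` — `|τ(θ)| ≤ k` (trivial bound for the Gauss sum);
* `norm_Zfac_conj` — `‖Z(s̄,θ)‖ = ‖Z(s,θ)‖` (`Γ(z̄) = conj Γ(z)`), reducing `t < 0` to `t > 0`;
* `norm_Zfac_le` — for `A ∈ ℕ`, `A ≥ 1`, `|σ| ≤ A`, `|t| ≥ 38(A+1)²`:
  `‖Z(σ+it,θ)‖ ≤ 4k^{A+1}|t|^{A+1}` (from (2.4) `Z = θ(−1)τ(θ)k^{−s}ϑ(s)(1+r)`, `|r| ≤ 3e^{−πt}`,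
  the tree's `GammaFactor.Zfac_eq`, and Stirling `|ϑ(σ+it)| = (t/2π)^{1/2−σ}(1+O(1/t))`, the tree's
  `abs_norm_rsChi_sub_rpow_le`);
* `norm_LFunction_le_of_abs_re_le` — for `θ` primitive mod `k ≠ 1`, `|σ| ≤ A`, `|t| ≥ 38(A+1)²`:
  `‖L(σ+it,θ)‖ ≤ 4k^{A+2}Z(|t|+A+1)^{A+2}`, `Z = Σ_{n≥1} n^{−5/4}` (for `σ ≥ 1/4` the tree's
  MV Lemma 10.15 `DirichletZFR.norm_LFunction_le_of_re_ge`; for `σ < 1/4` the functional equation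
  (2.2), the tree's `GammaFactor.LFunction_eq_Zfac_mul`, and the previous two items);
* `exists_norm_LFunction_le_pow` — **the consumable form**: for every `A ≥ 1` there is `C > 0` with
  `‖L(s,θ)‖ ≤ C(|Im s| + A + 1)^{A+2}` for ALL `s` with `|Re s| ≤ A` (compactness on `|t| ≤ 38(A+1)²`).

Standard (MV §10.1 Cor. 10.10: growth in vertical strips via the functional equation and Stirling).
Deliberately NOT here: convexity-strength exponents; anything about §6's error terms.

## References

* Y. Zhang, arXiv:2211.02515v1 (2022), §2 (2.2)–(2.4); §6 p. 31. [cite: Zhang2022LandauSiegel, §2 (2.2)–(2.4); §6 p.31]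
* H. L. Montgomery, R. C. Vaughan, *Multiplicative Number Theory I*, CUP 2007, §10.1–10.2
  (Cor. 10.10, Lemma 10.15). [cite: MontgomeryVaughan2007, §10.2 Lemma 10.15]
* E. C. Titchmarsh, *The Theory of the Riemann Zeta-Function*, 2nd ed. (1986), §4.12 (4.12.3).
  [cite: Titchmarsh1986, §4.12 eq. (4.12.3)]
-/

noncomputable section

open Complex Real ComplexConjugate

namespace Literature.NumberTheory.LFunctions.Zhang2022.StripGrowth

open GammaFactor

variable {k : ℕ} [NeZero k]

/-! ### §1. Trivial bounds for the factors of `Z(s,θ)` -/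

/-- The trivial bound `|τ(θ)| ≤ k` for the Gauss sum `τ(θ) = Σ_a θ(a)e(a/k)` (plumbing; the
true size for primitive `θ` is `√k`, MV Thm. 9.7). [folklore] -/
private theorem norm_tau_le (θ : DirichletCharacter ℂ k) : ‖tau θ‖ ≤ k := by
  unfold tau gaussSum
  calc ‖∑ a : ZMod k, θ a * ZMod.stdAddChar a‖
      ≤ ∑ a : ZMod k, ‖θ a * ZMod.stdAddChar a‖ := norm_sum_le _ _
    _ ≤ ∑ _a : ZMod k, (1 : ℝ) := by
        refine Finset.sum_le_sum fun a _ => ?_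
        rw [norm_mul, AddChar.norm_apply, mul_one]
        exact θ.norm_le_one a
    _ = k := by simp [ZMod.card]

/-- `‖Z(s̄,θ)‖ = ‖Z(s,θ)‖`: the gamma factors satisfy `Γ(z̄) = conj Γ(z)` and the powers of the
positive reals `π`, `k` have norms depending on `Re s` only (plumbing for `t < 0`). [folklore] -/
private theorem norm_Zfac_conj (θ : DirichletCharacter ℂ k) (s : ℂ) :
    ‖Zfac θ (conj s)‖ = ‖Zfac θ s‖ := by
  have hk : 0 < k := Nat.pos_of_ne_zero (NeZero.ne k)
  have hπ : ‖(π : ℂ) ^ (conj s - 1 / 2)‖ = ‖(π : ℂ) ^ (s - 1 / 2)‖ := by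
    rw [Complex.norm_cpow_eq_rpow_re_of_pos Real.pi_pos,
      Complex.norm_cpow_eq_rpow_re_of_pos Real.pi_pos]
    congr 1
  have hkp : ‖(k : ℂ) ^ (-conj s)‖ = ‖(k : ℂ) ^ (-s)‖ := by
    rw [Complex.norm_natCast_cpow_of_pos hk, Complex.norm_natCast_cpow_of_pos hk]
    congr 1
  have hG : ∀ a b : ℂ, (starRingEnd ℂ a = a) → (starRingEnd ℂ b = b) →
      ‖Complex.Gamma ((a - conj s) / b)‖ = ‖Complex.Gamma ((a - s) / b)‖ ∧
        ‖Complex.Gamma ((a + conj s) / b)‖ = ‖Complex.Gamma ((a + s) / b)‖ ∧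
        ‖Complex.Gamma (conj s / b)‖ = ‖Complex.Gamma (s / b)‖ := by
    intro a b ha hb
    refine ⟨?_, ?_, ?_⟩
    · have : (a - conj s) / b = conj ((a - s) / b) := by
        rw [map_div₀, map_sub, ha, hb]
      rw [this, Complex.Gamma_conj, Complex.norm_conj]
    · have : (a + conj s) / b = conj ((a + s) / b) := by
        rw [map_div₀, map_add, ha, hb]
      rw [this, Complex.Gamma_conj, Complex.norm_conj]
    · have : conj s / b = conj (s / b) := by
        rw [map_div₀, hb]
      rw [this, Complex.Gamma_conj, Complex.norm_conj]
  have h2 : starRingEnd ℂ (2 : ℂ) = 2 := map_ofNat _ 2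
  have h1 : starRingEnd ℂ (1 : ℂ) = 1 := map_one _
  obtain ⟨hG1, -, hG0⟩ := hG 1 2 h1 h2
  obtain ⟨hG2, hG1', -⟩ := hG 2 2 h2 h2
  obtain ⟨-, hG1'', -⟩ := hG 1 2 h1 h2
  unfold Zfac
  split_ifs with he
  · simp only [norm_mul, norm_inv, hπ, hkp, hG1, hG0]
  · simp only [norm_mul, norm_neg, norm_inv, hπ, hkp, hG2, hG1'']

/-- **The size of `Z(s,θ)` high in a strip**: for `A ∈ ℕ`, `A ≥ 1`, `|σ| ≤ A` and
`Im s ≥ 38(A+1)²`, `‖Z(s,θ)‖ ≤ 4k^{A+1}(Im s)^{A+1}` — from (2.4) (`Zfac_eq`: `Z = θ(−1)τ(θ)k^{−s}ϑ(s)(1+r)`,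
`|r| ≤ 3e^{−πt}`) and Stirling for `ϑ = χ` (`|χ(σ+it)| ≤ (1 + 38(A+1)²/t)(t/2π)^{1/2−σ}`); this is
the factor `(qτ)^{1/2−σ}` of MV Cor. 10.10 in crude polynomial form.
[cite: MontgomeryVaughan2007, §10.1 Cor. 10.10] -/
theorem norm_Zfac_le_of_im_pos (θ : DirichletCharacter ℂ k) {A : ℕ} (hA : 1 ≤ A) {s : ℂ}
    (hσ : |s.re| ≤ A) (ht : 38 * ((A : ℝ) + 1) ^ 2 ≤ s.im) :
    ‖Zfac θ s‖ ≤ 4 * (k : ℝ) ^ (A + 1) * s.im ^ (A + 1) := by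
  have hA' : (1 : ℝ) ≤ A := by exact_mod_cast hA
  have hA1 : (1 : ℝ) ≤ ((A : ℝ) + 1) ^ 2 := one_le_pow₀ (by linarith)
  have ht1 : (152 : ℝ) ≤ s.im := le_trans (by nlinarith) ht
  have ht0 : 0 < s.im := by linarith
  have hk : 0 < k := Nat.pos_of_ne_zero (NeZero.ne k)
  have hk1 : (1 : ℝ) ≤ k := by exact_mod_cast hk
  -- (2.4)
  rw [Zfac_eq θ ht0, vartheta_eq_rsChi ht0.ne']
  -- the factors
  have f1 : ‖θ (-1)‖ ≤ 1 := θ.norm_le_one _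
  have f2 : ‖tau θ‖ ≤ k := norm_tau_le θ
  have f3 : ‖(k : ℂ) ^ (-s)‖ ≤ (k : ℝ) ^ A := by
    rw [Complex.norm_natCast_cpow_of_pos hk, neg_re]
    calc (k : ℝ) ^ (-s.re) ≤ (k : ℝ) ^ (A : ℝ) :=
          Real.rpow_le_rpow_of_exponent_le hk1 (by linarith [(abs_le.1 hσ).1])
      _ = (k : ℝ) ^ A := Real.rpow_natCast _ _
  have f4 : ‖SiegelIntegral.rsChi s‖ ≤ 2 * s.im ^ (A + 1) := by
    have hσA : |s.re| ≤ (A : ℝ) := hσ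
    have key := abs_norm_rsChi_sub_rpow_le (A := A) (σ := s.re) (t := s.im) hA' hσA ht
    rw [Complex.re_add_im] at key
    have hb1 : (1 : ℝ) ≤ s.im / (2 * π) := by
      rw [le_div_iff₀ (by positivity)]
      nlinarith [Real.pi_lt_four]
    have hbt : s.im / (2 * π) ≤ s.im := by
      rw [div_le_iff₀ (by positivity)]
      nlinarith [Real.pi_gt_three]
    have hpow : (s.im / (2 * π)) ^ (1 / 2 - s.re) ≤ s.im ^ (A + 1) := by
      calc (s.im / (2 * π)) ^ (1 / 2 - s.re)
          ≤ (s.im / (2 * π)) ^ ((A : ℝ) + 1) :=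
            Real.rpow_le_rpow_of_exponent_le hb1 (by linarith [(abs_le.1 hσ).1])
        _ ≤ s.im ^ ((A : ℝ) + 1) :=
            Real.rpow_le_rpow (by positivity) hbt (by positivity)
        _ = s.im ^ (A + 1) := by
            rw [← Real.rpow_natCast]; push_cast; ring_nf
    have hcoef : 38 * ((A : ℝ) + 1) ^ 2 / s.im ≤ 1 := by
      rw [div_le_one ht0]; exact ht
    have hpos : 0 ≤ (s.im / (2 * π)) ^ (1 / 2 - s.re) := Real.rpow_nonneg (by positivity) _
    have := (abs_le.1 key).2
    calc ‖SiegelIntegral.rsChi s‖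
        ≤ (s.im / (2 * π)) ^ (1 / 2 - s.re) +
            38 * ((A : ℝ) + 1) ^ 2 / s.im * (s.im / (2 * π)) ^ (1 / 2 - s.re) := by linarith
      _ ≤ (s.im / (2 * π)) ^ (1 / 2 - s.re) + 1 * (s.im / (2 * π)) ^ (1 / 2 - s.re) := by
          gcongr
      _ = 2 * (s.im / (2 * π)) ^ (1 / 2 - s.re) := by ring
      _ ≤ 2 * s.im ^ (A + 1) := by gcongr
  have f5 : ‖1 + corr θ s‖ ≤ 2 := by
    have h1 : (1 : ℝ) ≤ s.im := by linarith
    have hc := norm_corr_le θ h1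
    have he : Real.exp (-π * s.im) ≤ 1 / 3 := exp_neg_pi_mul_le h1
    calc ‖1 + corr θ s‖ ≤ ‖(1 : ℂ)‖ + ‖corr θ s‖ := norm_add_le _ _
      _ ≤ 1 + 3 * Real.exp (-π * s.im) := by rw [norm_one]; gcongr
      _ ≤ 2 := by linarith
  have hpos4 : 0 ≤ s.im ^ (A + 1) := by positivity
  calc ‖θ (-1) * tau θ * (k : ℂ) ^ (-s) * SiegelIntegral.rsChi s * (1 + corr θ s)‖
      = ‖θ (-1)‖ * ‖tau θ‖ * ‖(k : ℂ) ^ (-s)‖ * ‖SiegelIntegral.rsChi s‖ * ‖1 + corr θ s‖ := by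
        simp only [norm_mul]
    _ ≤ 1 * k * (k : ℝ) ^ A * (2 * s.im ^ (A + 1)) * 2 := by
        gcongr
    _ = 4 * (k : ℝ) ^ (A + 1) * s.im ^ (A + 1) := by ring

/-- **The size of `Z(s,θ)` high or low in a strip**: for `A ∈ ℕ`, `A ≥ 1`, `|σ| ≤ A` and
`|Im s| ≥ 38(A+1)²`, `‖Z(s,θ)‖ ≤ 4k^{A+1}|Im s|^{A+1}` (negative `t` by `‖Z(s̄,θ)‖ = ‖Z(s,θ)‖`);
the factor `(qτ)^{1/2−σ}` of MV Cor. 10.10 in crude polynomial form.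
[cite: MontgomeryVaughan2007, §10.1 Cor. 10.10] -/
theorem norm_Zfac_le (θ : DirichletCharacter ℂ k) {A : ℕ} (hA : 1 ≤ A) {s : ℂ}
    (hσ : |s.re| ≤ A) (ht : 38 * ((A : ℝ) + 1) ^ 2 ≤ |s.im|) :
    ‖Zfac θ s‖ ≤ 4 * (k : ℝ) ^ (A + 1) * |s.im| ^ (A + 1) := by
  rcases le_or_gt 0 s.im with h | h
  · rw [abs_of_nonneg h] at ht ⊢
    exact norm_Zfac_le_of_im_pos θ hA hσ ht
  · rw [abs_of_neg h] at ht ⊢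
    have h1 := norm_Zfac_le_of_im_pos θ hA (s := conj s) (by simpa using hσ) (by simpa using ht)
    rw [norm_Zfac_conj] at h1
    simpa using h1

/-- **The size of `Z(s,θ)` on the closed half-strip `−A ≤ σ ≤ 0`, uniformly in the character**:
for `A ∈ ℕ`, `A ≥ 1` there is an absolute `G > 0` with `‖Z(s,θ)‖ ≤ G·k^{A+1}(|Im s| + A + 1)^{A+1}`
for every modulus `k`, every `θ (mod k)` and every `s` with `−A ≤ Re s ≤ 0` (high `|t|`:
`norm_Zfac_le`; bounded `|t|`: the gamma quotients `Γ((1−s)/2)/Γ(s/2)`, `Γ((2−s)/2)/Γ((1+s)/2)` are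
pole-free on `Re s ≤ 0`, hence bounded on a compact rectangle, and `|τ(θ)| ≤ k`, `π^{σ−1/2} ≤ 1`,
`k^{−σ} ≤ k^A`). The factor `(qτ)^{1/2−σ}` of MV Cor. 10.10, crude and uniform.
[cite: MontgomeryVaughan2007, §10.1 Cor. 10.10] -/
theorem exists_norm_Zfac_le {A : ℕ} (hA : 1 ≤ A) :
    ∃ G : ℝ, 0 < G ∧ ∀ (k : ℕ) [NeZero k] (θ : DirichletCharacter ℂ k) (s : ℂ),
      -(A : ℝ) ≤ s.re → s.re ≤ 0 →
        ‖Zfac θ s‖ ≤ G * (k : ℝ) ^ (A + 1) * (|s.im| + A + 1) ^ (A + 1) := by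
  set T : ℝ := 38 * ((A : ℝ) + 1) ^ 2 with hT
  set R : Set ℂ := Set.Icc (-(A : ℝ)) 0 ×ℂ Set.Icc (-T) T with hR
  have hRc : IsCompact R := isCompact_Icc.reProdIm isCompact_Icc
  have hA0 : (0 : ℝ) ≤ A := Nat.cast_nonneg A
  -- the two gamma quotients are continuous on `R` (no poles for `Re s ≤ 0`)
  have hΓ : ∀ a : ℂ, 0 < a.re → ContinuousOn (fun s : ℂ => Complex.Gamma ((a - s) / 2)) R := by
    intro a ha s hs
    rw [hR, Complex.mem_reProdIm] at hs
    refine ContinuousAt.continuousWithinAt ?_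
    refine ContinuousAt.comp (g := Complex.Gamma) ?_
      ((continuousAt_const.sub continuousAt_id).div_const _)
    refine (Complex.differentiableAt_Gamma _ fun m h => ?_).continuousAt
    have := congrArg Complex.re h
    simp at this
    have hm : (0 : ℝ) ≤ m := Nat.cast_nonneg m
    linarith [hs.1.2]
  have hΓinv : ∀ a : ℂ, ContinuousOn (fun s : ℂ => (Complex.Gamma ((a + s) / 2))⁻¹) R := fun a =>
    (Complex.differentiable_one_div_Gamma.continuous.comp (by fun_prop)).continuousOn
  obtain ⟨M₁, hM₁⟩ := hRc.exists_bound_of_continuousOn ((hΓ 1 (by simp)).mul (hΓinv 0))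
  obtain ⟨M₂, hM₂⟩ := hRc.exists_bound_of_continuousOn ((hΓ 2 (by simp)).mul (hΓinv 1))
  set G : ℝ := max 4 (max M₁ M₂) with hGdef
  refine ⟨G, lt_max_of_lt_left (by norm_num), fun k _ θ s hσ1 hσ2 => ?_⟩
  have hk : 0 < k := Nat.pos_of_ne_zero (NeZero.ne k)
  have hk1 : (1 : ℝ) ≤ k := by exact_mod_cast hk
  have hσ : |s.re| ≤ A := abs_le.2 ⟨hσ1, by linarith⟩
  have hX1 : 1 ≤ (|s.im| + A + 1) ^ (A + 1) := one_le_pow₀ (by linarith [abs_nonneg s.im])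
  have hG4 : (4 : ℝ) ≤ G := le_max_left _ _
  have hG0 : (0 : ℝ) ≤ G := by linarith
  rcases le_or_gt T |s.im| with ht | ht
  · calc ‖Zfac θ s‖ ≤ 4 * (k : ℝ) ^ (A + 1) * |s.im| ^ (A + 1) := norm_Zfac_le θ hA hσ ht
      _ ≤ G * (k : ℝ) ^ (A + 1) * (|s.im| + A + 1) ^ (A + 1) := by
          gcongr; linarith
  · have hmem : s ∈ R := by
      rw [hR, Complex.mem_reProdIm]; exact ⟨⟨hσ1, hσ2⟩, abs_le.1 ht.le⟩
    have f2 : ‖tau θ‖ ≤ k := norm_tau_le θ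
    have f3 : ‖(π : ℂ) ^ (s - 1 / 2)‖ ≤ 1 := by
      rw [Complex.norm_cpow_eq_rpow_re_of_pos Real.pi_pos]
      apply Real.rpow_le_one_of_one_le_of_nonpos (by linarith [Real.pi_gt_three])
      simp; linarith
    have f4 : ‖(k : ℂ) ^ (-s)‖ ≤ (k : ℝ) ^ A := by
      rw [Complex.norm_natCast_cpow_of_pos hk, neg_re]
      calc (k : ℝ) ^ (-s.re) ≤ (k : ℝ) ^ (A : ℝ) :=
            Real.rpow_le_rpow_of_exponent_le hk1 (by linarith)
        _ = (k : ℝ) ^ A := Real.rpow_natCast _ _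
    -- the common final estimate, `q` = the norm of the gamma quotient of the relevant parity
    have hfin : ∀ q : ℝ, 0 ≤ q → q ≤ max M₁ M₂ →
        ‖tau θ‖ * ‖(π : ℂ) ^ (s - 1 / 2)‖ * ‖(k : ℂ) ^ (-s)‖ * q ≤
          G * (k : ℝ) ^ (A + 1) * (|s.im| + A + 1) ^ (A + 1) := by
      intro q hq0 hq
      have hq' : q ≤ G := hq.trans (le_max_right _ _)
      calc ‖tau θ‖ * ‖(π : ℂ) ^ (s - 1 / 2)‖ * ‖(k : ℂ) ^ (-s)‖ * q
          ≤ k * 1 * (k : ℝ) ^ A * G := by gcongr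
        _ = G * (k : ℝ) ^ (A + 1) * 1 := by ring
        _ ≤ G * (k : ℝ) ^ (A + 1) * (|s.im| + A + 1) ^ (A + 1) := by gcongr
    unfold Zfac
    split_ifs with he
    · have hg := hM₁ s hmem
      simp only [Pi.mul_apply, zero_add, norm_mul, norm_inv] at hg ⊢
      calc ‖tau θ‖ * ‖(π : ℂ) ^ (s - 1 / 2)‖ * ‖(k : ℂ) ^ (-s)‖ * ‖Complex.Gamma ((1 - s) / 2)‖ *
            ‖Complex.Gamma (s / 2)‖⁻¹
          = ‖tau θ‖ * ‖(π : ℂ) ^ (s - 1 / 2)‖ * ‖(k : ℂ) ^ (-s)‖ *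
              (‖Complex.Gamma ((1 - s) / 2)‖ * ‖Complex.Gamma (s / 2)‖⁻¹) := by ring
        _ ≤ _ := hfin _ (by positivity) (hg.trans (le_max_left _ _))
    · have hg := hM₂ s hmem
      simp only [Pi.mul_apply, norm_mul, norm_neg, Complex.norm_I, one_mul, norm_inv] at hg ⊢
      calc ‖tau θ‖ * ‖(π : ℂ) ^ (s - 1 / 2)‖ * ‖(k : ℂ) ^ (-s)‖ * ‖Complex.Gamma ((2 - s) / 2)‖ *
            ‖Complex.Gamma ((1 + s) / 2)‖⁻¹
          = ‖tau θ‖ * ‖(π : ℂ) ^ (s - 1 / 2)‖ * ‖(k : ℂ) ^ (-s)‖ *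
              (‖Complex.Gamma ((2 - s) / 2)‖ * ‖Complex.Gamma ((1 + s) / 2)‖⁻¹) := by ring
        _ ≤ _ := hfin _ (by positivity) (hg.trans (le_max_right _ _))

/-! ### §2. Polynomial growth of `L(s,θ)` -/

/-- **Polynomial growth in the strip `|σ| ≤ A`, `|t| ≥ 38(A+1)²`**: for `θ` primitive mod `k ≠ 1`,
`‖L(s,θ)‖ ≤ 4k^{A+2}Z(|t| + A + 1)^{A+2}`. For `σ ≥ 1/4` this is MV Lemma 10.15
(`‖L(s,θ)‖ ≤ k‖s‖Z`); for `σ < 1/4` the functional equation `L(s,θ) = Z(s,θ)L(1−s,θ̄)` (2.2)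
with `Re(1−s) > 3/4` and `norm_Zfac_le` — MV Cor. 10.10 "`|L(s,χ)| ≍ (qτ)^{1/2−σ}|L(1−s,χ̄)|`
uniformly for `|σ| ≤ A`, `|t| ≥ 1`", in crude explicit form.
[cite: MontgomeryVaughan2007, §10.1 Cor. 10.10] -/
theorem norm_LFunction_le_of_abs_re_le {θ : DirichletCharacter ℂ k} (hθ : θ.IsPrimitive)
    (hk : k ≠ 1) {A : ℕ} (hA : 1 ≤ A) {s : ℂ} (hσ : |s.re| ≤ A)
    (ht : 38 * ((A : ℝ) + 1) ^ 2 ≤ |s.im|) :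
    ‖θ.LFunction s‖ ≤ 4 * (k : ℝ) ^ (A + 2) * (∑' n : ℕ, ((n + 1 : ℕ) : ℝ) ^ (-(5 / 4 : ℝ))) *
      (|s.im| + A + 1) ^ (A + 2) := by
  set Zconst : ℝ := ∑' n : ℕ, ((n + 1 : ℕ) : ℝ) ^ (-(5 / 4 : ℝ)) with hZdef
  have one_le_Zconst : 1 ≤ Zconst := DirichletZFR.one_le_tsum_rpow
  have hθ1 : θ ≠ 1 := ne_one_of_isPrimitive hθ hk
  have hA' : (1 : ℝ) ≤ A := by exact_mod_cast hA
  have hk0 : 0 < k := Nat.pos_of_ne_zero (NeZero.ne k)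
  have hk1 : (1 : ℝ) ≤ k := by exact_mod_cast hk0
  have hZ1 := one_le_Zconst
  have hA1 : (1 : ℝ) ≤ ((A : ℝ) + 1) ^ 2 := one_le_pow₀ (by linarith)
  have ht1 : (1 : ℝ) ≤ |s.im| := le_trans (by nlinarith) ht
  have hσ1 := (abs_le.1 hσ).1
  have hσ2 := (abs_le.1 hσ).2
  set X : ℝ := |s.im| + A + 1 with hX
  have hX1 : 1 ≤ X := by rw [hX]; linarith [abs_nonneg s.im]
  have hXpow : ∀ m n : ℕ, m ≤ n → X ^ m ≤ X ^ n := fun m n h => pow_le_pow_right₀ hX1 h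
  -- the generic final step: `a ≤ k Z X` ⇒ `a ≤ 4 k^{A+2} Z X^{A+2}`
  have lift : (k : ℝ) * Zconst * X ≤ 4 * (k : ℝ) ^ (A + 2) * Zconst * X ^ (A + 2) := by
    have h1 : (k : ℝ) ≤ (k : ℝ) ^ (A + 2) := by
      calc (k : ℝ) = (k : ℝ) ^ 1 := (pow_one _).symm
        _ ≤ (k : ℝ) ^ (A + 2) := pow_le_pow_right₀ hk1 (by omega)
    have h2 : X ≤ X ^ (A + 2) := by
      calc X = X ^ 1 := (pow_one _).symm
        _ ≤ X ^ (A + 2) := hXpow 1 (A + 2) (by omega)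
    have h3 : (0 : ℝ) ≤ (k : ℝ) ^ (A + 2) * Zconst * X ^ (A + 2) := by positivity
    calc (k : ℝ) * Zconst * X ≤ (k : ℝ) ^ (A + 2) * Zconst * X ^ (A + 2) := by
          gcongr
      _ ≤ 4 * ((k : ℝ) ^ (A + 2) * Zconst * X ^ (A + 2)) := by linarith
      _ = _ := by ring
  rcases le_or_gt (1 / 4 : ℝ) s.re with hre | hre
  · -- MV Lemma 10.15 directly
    have h := DirichletZFR.norm_LFunction_le_of_re_ge θ hθ1 hre
    have hs : ‖s‖ ≤ X := by
      calc ‖s‖ ≤ |s.re| + |s.im| := Complex.norm_le_abs_re_add_abs_im s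
        _ ≤ A + |s.im| := by linarith
        _ ≤ X := by rw [hX]; linarith
    calc ‖θ.LFunction s‖ ≤ k * ‖s‖ * Zconst := h
      _ ≤ k * X * Zconst := by gcongr
      _ = k * Zconst * X := by ring
      _ ≤ _ := lift
  · -- functional equation
    have him : s.im ≠ 0 := by
      intro h0; rw [h0, abs_zero] at ht1; linarith
    rw [LFunction_eq_Zfac_mul hθ hk him, norm_mul]
    have hθ1' : θ⁻¹ ≠ 1 := inv_ne_one.mpr hθ1
    have hre' : (1 / 4 : ℝ) ≤ (1 - s).re := by simp; linarith
    have hL : ‖θ⁻¹.LFunction (1 - s)‖ ≤ k * ‖1 - s‖ * Zconst :=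
      DirichletZFR.norm_LFunction_le_of_re_ge θ⁻¹ hθ1' hre'
    have hs : ‖1 - s‖ ≤ X := by
      calc ‖1 - s‖ ≤ |(1 - s).re| + |(1 - s).im| := Complex.norm_le_abs_re_add_abs_im _
        _ = |1 - s.re| + |s.im| := by simp [abs_neg]
        _ ≤ (1 + A) + |s.im| := by
            gcongr
            rw [abs_le]; constructor <;> linarith
        _ = X := by rw [hX]; ring
    have hZf := norm_Zfac_le θ hA hσ ht
    have htX : |s.im| ≤ X := by rw [hX]; linarith
    calc ‖Zfac θ s‖ * ‖θ⁻¹.LFunction (1 - s)‖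
        ≤ (4 * (k : ℝ) ^ (A + 1) * |s.im| ^ (A + 1)) * (k * ‖1 - s‖ * Zconst) := by
          gcongr
      _ ≤ (4 * (k : ℝ) ^ (A + 1) * X ^ (A + 1)) * (k * X * Zconst) := by
          gcongr
      _ = 4 * (k : ℝ) ^ (A + 2) * Zconst * X ^ (A + 2) := by ring

/-- **Polynomial growth of `L(s,θ)` in the whole strip `|σ| ≤ A`** (the consumable form): for `θ`
primitive mod `k ≠ 1` and `A ∈ ℕ`, `A ≥ 1`, there is `C > 0` with
`‖L(s,θ)‖ ≤ C(|Im s| + A + 1)^{A+2}` for every `s` with `|Re s| ≤ A` (on `|t| ≤ 38(A+1)²` by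
continuity of the entire function `L(·,θ)` on a compact rectangle) — the qualitative content of
MV Cor. 10.10 ("uniformly for `|σ| ≤ A`"). [cite: MontgomeryVaughan2007, §10.1 Cor. 10.10] -/
theorem exists_norm_LFunction_le_pow {θ : DirichletCharacter ℂ k} (hθ : θ.IsPrimitive)
    (hk : k ≠ 1) {A : ℕ} (hA : 1 ≤ A) :
    ∃ C : ℝ, 0 < C ∧ ∀ s : ℂ, |s.re| ≤ A →
      ‖θ.LFunction s‖ ≤ C * (|s.im| + A + 1) ^ (A + 2) := by
  have hθ1 : θ ≠ 1 := ne_one_of_isPrimitive hθ hk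
  set Zconst : ℝ := ∑' n : ℕ, ((n + 1 : ℕ) : ℝ) ^ (-(5 / 4 : ℝ)) with hZdef
  have one_le_Zconst : 1 ≤ Zconst := DirichletZFR.one_le_tsum_rpow
  set T : ℝ := 38 * ((A : ℝ) + 1) ^ 2 with hT
  -- compactness on the rectangle `[-A, A] × [-T, T]`
  have hK : IsCompact (Set.Icc (-(A : ℝ)) A ×ℂ Set.Icc (-T) T) :=
    isCompact_Icc.reProdIm isCompact_Icc
  have hcont : ContinuousOn θ.LFunction (Set.Icc (-(A : ℝ)) A ×ℂ Set.Icc (-T) T) :=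
    (DirichletCharacter.differentiable_LFunction hθ1).continuous.continuousOn
  obtain ⟨M, hM⟩ := hK.exists_bound_of_continuousOn hcont
  have hk0 : 0 < k := Nat.pos_of_ne_zero (NeZero.ne k)
  have hpos : 0 < 4 * (k : ℝ) ^ (A + 2) * Zconst := by
    have hZ := one_le_Zconst
    have hk' : (0 : ℝ) < 4 * (k : ℝ) ^ (A + 2) := by positivity
    nlinarith
  have hC0 : 0 < max M 0 + 4 * (k : ℝ) ^ (A + 2) * Zconst := by
    linarith [le_max_right M 0]
  refine ⟨max M 0 + 4 * (k : ℝ) ^ (A + 2) * Zconst, hC0, fun s hσ => ?_⟩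
  have hX1 : 1 ≤ (|s.im| + A + 1) ^ (A + 2) := by
    have : (1 : ℝ) ≤ |s.im| + A + 1 := by
      have : (0 : ℝ) ≤ A := Nat.cast_nonneg A
      linarith [abs_nonneg s.im]
    exact one_le_pow₀ this
  rcases le_or_gt T |s.im| with ht | ht
  · have h := norm_LFunction_le_of_abs_re_le hθ hk hA hσ ht
    calc ‖θ.LFunction s‖ ≤ 4 * (k : ℝ) ^ (A + 2) * Zconst * (|s.im| + A + 1) ^ (A + 2) := h
      _ ≤ (max M 0 + 4 * (k : ℝ) ^ (A + 2) * Zconst) * (|s.im| + A + 1) ^ (A + 2) :=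
          mul_le_mul_of_nonneg_right (le_add_of_nonneg_left (le_max_right _ _))
            (by positivity)
  · have hmem : s ∈ Set.Icc (-(A : ℝ)) A ×ℂ Set.Icc (-T) T := by
      rw [Complex.mem_reProdIm]
      exact ⟨abs_le.1 hσ, abs_le.1 ht.le⟩
    calc ‖θ.LFunction s‖ ≤ M := hM s hmem
      _ ≤ max M 0 + 4 * (k : ℝ) ^ (A + 2) * Zconst := by
          linarith [le_max_left M 0]
      _ = (max M 0 + 4 * (k : ℝ) ^ (A + 2) * Zconst) * 1 := (mul_one _).symm
      _ ≤ (max M 0 + 4 * (k : ℝ) ^ (A + 2) * Zconst) * (|s.im| + A + 1) ^ (A + 2) :=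
          mul_le_mul_of_nonneg_left hX1 hC0.le

end Literature.NumberTheory.LFunctions.Zhang2022.StripGrowth
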